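import Summits.Langlands.Langlands.Theorems.ParityBlindBianchiResidualBianchiDoorMod2TwoAdicModel
import HarnessLib

/-!
# Stub `stub_projectiveImageOfModel` (S7) of the line `SketchIdeator2` for the crux
# `ParityBlindBianchi.ArtinWeightRealisationEven` (item stmt-Langlands-16619)

Let `ρ : Γ_ℚ → GL₂(ℂ)` have projective image `A₅`, `ι : ℚ̄_p ≃+* ℂ`, `K` a quadratic number field,
and let `σ : Γ_K → GL₂(ℚ̄_p)` be given only through the entrywise relation
`ι (σ(g)_{ij}) = ρ|_K(g)_{ij}`.  Then the projective image of `σ` is `A₅`.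

Proof: `ResidualBianchiDoorMod2.exists_padicModel_restrictField ι ρ _ K _` supplies a model
`σ₀ : Γ_ℚ → GL₂(ℚ̄_p)` whose restriction `σ₀|_K` satisfies the same entrywise relation and has
projective image `A₅`.  Since `ι` is injective the two relations force `σ(g)_{ij} = σ₀|_K(g)_{ij}`
for all `g i j`, so `σ = σ₀|_K` as monoid homomorphisms, and the conclusion transfers.
-/

-- the line's namespace `Summit.Langlands.Langlands.…` (summit = problem = `Langlands`) repeats a
-- component by design
set_option linter.dupNamespace false

namespace Summit.Langlands.Langlands.Theorems.ArtinWeightRealisationEven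

open scoped MatrixGroups Matrix Polynomial NumberField
open NumberField IsDedekindDomain Polynomial Field
open Literature.NumberTheory.Automorphic Literature.NumberTheory.GaloisRepresentations

/-- Two framed Galois representations of `K` with coefficients in `ℚ̄_p` whose entries have the
same images under a ring isomorphism `ι : ℚ̄_p ≃+* ℂ` have equal underlying monoid homomorphisms
(`ι` is injective, matrices and units are determined by their entries). -/
theorem toMonoidHom_eq_of_entrywise_model {p : ℕ} [Fact p.Prime] (ι : PadicAlgCl p ≃+* ℂ)
    {K : Type} [Field K] {σ τ : FramedGaloisRep K (PadicAlgCl p) 2}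
    (f : absoluteGaloisGroup K → Fin 2 → Fin 2 → ℂ)
    (hσ : ∀ (g : absoluteGaloisGroup K) (i j : Fin 2), ι ((σ g).val i j) = f g i j)
    (hτ : ∀ (g : absoluteGaloisGroup K) (i j : Fin 2), ι ((τ g).val i j) = f g i j) :
    σ.toMonoidHom = τ.toMonoidHom := by
  refine MonoidHom.ext fun g => ?_
  change σ g = τ g
  exact Units.ext (Matrix.ext fun i j => ι.injective ((hσ g i j).trans (hτ g i j).symm))

/-- S7 (projective image of the model): the entrywise ι-model `σ` of `ρ|_K` (ρ of icosahedral type over `ℚ`,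
`K` quadratic) has projective image `A₅` (`Theorems.ResidualBianchiDoorMod2.exists_padicModel_restrictField`). -/
theorem stub_projectiveImageOfModel :
    ∀ (p : ℕ) [Fact p.Prime] (ι : PadicAlgCl p ≃+* ℂ) (ρ : FramedGaloisRep ℚ ℂ 2),
      Nonempty ((Matrix.ProjGenLinGroup.mk.comp ρ.toMonoidHom).range ≃* alternatingGroup (Fin 5)) →
      ∀ (K : Type) [Field K] [NumberField K], Module.finrank ℚ K = 2 →
      ∀ (σ : FramedGaloisRep K (PadicAlgCl p) 2),
      (∀ (g : absoluteGaloisGroup K) (i j : Fin 2),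
          ι ((σ g).val i j) = ((FramedGaloisRep.restrictField K ρ) g).val i j) →
      Nonempty ((Matrix.ProjGenLinGroup.mk.comp σ.toMonoidHom).range ≃* alternatingGroup (Fin 5)) := by
  intro p _ ι ρ hico K _ _ hK σ hmodel
  obtain ⟨σ₀, -, -, -, hmodel₀, -, -, hA5⟩ :=
    Summit.Langlands.Langlands.Theorems.ResidualBianchiDoorMod2.exists_padicModel_restrictField
      ι ρ hico K hK
  have hστ : σ.toMonoidHom = (σ₀.restrictField K).toMonoidHom :=
    toMonoidHom_eq_of_entrywise_model ι (fun g i j => ((FramedGaloisRep.restrictField K ρ) g).val i j)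
      hmodel hmodel₀
  rw [hστ]
  exact hA5

end Summit.Langlands.Langlands.Theorems.ArtinWeightRealisationEven
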